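import Summits.AtomisticToContinuum.Crystallization.Theorems.FrustratedLawDichotomyStrainedPatchHomSlopeLJAffine
import Summits.AtomisticToContinuum.Crystallization.Theorems.FrustratedLawDichotomyStrainedPatchHomSlopePathThird

/-!
# The PER-LABEL THIRD-ORDER slope estimate of the pure Lennard-Jones profile (real side of the second-order centred slope leaf, K1-v2)
# (27623 `(H) HomFloor (1/625)`, hcp half; hand-1 g34 FINDING §4)

decomp-a2c hand-1 g34 (crux `AperiodicFrustratedLawGap`, stmt-AtomisticToContinuum-27623).  One Taylor order beyond `…HomSlopeLJ.label_slope_LJ`: with the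
centre data `α₀ = α(ρ₀)`, `β₀ = β(ρ₀)`, `a₁ = α′(ρ₀)/ρ₀` of a centred label (`ρ₀ = ‖p_b‖`) and `d = c_b − p_b`,

  ★ `label_slope3_LJ`: `|β(‖c_b‖)⟪c_b,Δ⟫ − β₀⟪p_b,Δ⟫ − (α₀⟪p_b,d⟫⟪p_b,Δ⟫ + β₀⟪d,Δ⟫) − ((a₁⟪p_b,d⟫² + α₀‖d‖²)⟪p_b,Δ⟫ + 2α₀⟪p_b,d⟫⟪d,Δ⟫)/2|
     ≤ (K₃/SC)/6 · (nd3/SC) · ‖Δ‖`, `K₃ = kSlope3S tt` (`≥ SC·(|α″ρ²| + 8|α′ρ| + 12|α|)` on the tube, ★ `kSlope3_of_mem`), `nd3 = nd3S` (`≥ SC·‖d‖³`);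
  ★ `quadSlope_eq`: the quadratic term is `Σ_i (Σ_k Σ_k' Dreal a₁ α₀ p_b k k' i · d_k d_k') Δ_i` — the third-derivative tensor of `…HomCurvCentreKit.Dreal`,
     so the kernel encloses it with the curvature kit's `Darr (recLJ …)`.

KERNEL PROJECTION (seat probes `R2–R4`, second-order centred AFFINE form built on this estimate, near chunk `g₀ + linA + quad + res + rem3`):
W10 `7.6e-4·SC` (first-order form `1.2e-2`, constant reference `1.8e-2`), `cB065` cube `2⁻¹⁰` `1.07e-3` (`1.6e-2` / `2.0e-2`), cube `2⁻⁹` `6.8e-3` (`7.1e-2` / `5.5e-2`).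

NO new payloads; definitions `kSlope3S`, `nd3S`; 0 sorry; standard axioms; no instances / notation / `#eval`.  `--supports stmt-AtomisticToContinuum-27623`.
-/

noncomputable section

namespace Summit.AtomisticToContinuum.Crystallization.Theorems.FrustratedLawDichotomyStrainedPatchHomSlopeLJThird

open scoped BigOperators RealInnerProductSpace
open Literature.Analysis.ValidatedNumerics.Numerics
open Summit.AtomisticToContinuum.Crystallization.Theorems.ChargedEnergyGapNegative (E3)
open Summit.AtomisticToContinuum.Crystallization.Theorems.FrustratedLawDichotomyStrainedPatchHomSplit (latPt hexFrame hcpShift)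
open Summit.AtomisticToContinuum.Crystallization.Theorems.FrustratedLawDichotomyStrainedPatchHomEntryGramHcp (dot3 mem_dot3)
open Summit.AtomisticToContinuum.Crystallization.Theorems.FrustratedLawDichotomyStrainedPatchHomCurvCoeff3 (ljTripleFI mem_ljTripleFI)
open Summit.AtomisticToContinuum.Crystallization.Theorems.FrustratedLawDichotomyStrainedPatchHomCurvRegime3
open Summit.AtomisticToContinuum.Crystallization.Theorems.FrustratedLawDichotomyStrainedPatchHomConvexCurvature (inner_eq_sum3 norm_sq_eq_sum)
open Summit.AtomisticToContinuum.Crystallization.Theorems.FrustratedLawDichotomyStrainedPatchHomCurvCentreKit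
open Summit.AtomisticToContinuum.Crystallization.Theorems.FrustratedLawDichotomyStrainedPatchHomForceKit (phiFI)
open Summit.AtomisticToContinuum.Crystallization.Theorems.FrustratedLawDichotomyStrainedPatchHomCurvLJ (betaLJ_of_mem_phiFI)
open Summit.AtomisticToContinuum.Crystallization.Theorems.FrustratedLawDichotomyStrainedPatchHomSlopePathThird (slopeForm_thirdOrder)
open Summit.AtomisticToContinuum.Crystallization.Theorems.FrustratedLawDichotomyStrainedPatchTaylorChord (segR)

/-! ## §1. The third-order remainder constant -/

/-- Scaled third-order remainder constant from the tube triple `(α, α′ρ, α″ρ²)`: `|α″ρ²|↑ + 8|α′ρ|↑ + 12|α|↑`. -/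
def kSlope3S (tt : FI × FI × FI) : ℤ := tt.2.2.absHi + 8 * tt.2.1.absHi + 12 * tt.1.absHi

/-- ★ `kSlope3S` bounds `|B₃|r + 6|B₂| + 6|B₁|/r` for `B₁ = αr`, `B₂ = α′r + α`, `B₃ = α″r + 2α′`. [folklore] -/
theorem kSlope3_of_mem {A A1 A2 r : ℝ} (hr : 0 < r) {tt : FI × FI × FI} (h0 : FI.mem A tt.1) (h1 : FI.mem (A1 * r) tt.2.1) (h2 : FI.mem (A2 * r ^ 2) tt.2.2) :
    |A2 * r + 2 * A1| * r + 6 * |A1 * r + A| + 6 * |A * r| / r ≤ ((kSlope3S tt : ℤ) : ℝ) / SC := by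
  have hS : (0 : ℝ) < SC := by norm_num [SC]
  have ha : |A| ≤ (tt.1.absHi : ℝ) / SC := by rw [le_div_iff₀ hS]; exact FI.abs_le_absHi h0
  have hb : |A1 * r| ≤ (tt.2.1.absHi : ℝ) / SC := by rw [le_div_iff₀ hS]; exact FI.abs_le_absHi h1
  have hc : |A2 * r ^ 2| ≤ (tt.2.2.absHi : ℝ) / SC := by rw [le_div_iff₀ hS]; exact FI.abs_le_absHi h2
  have e1 : |A2 * r + 2 * A1| * r = |A2 * r ^ 2 + 2 * (A1 * r)| := by
    rw [← abs_of_pos hr, ← abs_mul, abs_of_pos hr]; ring_nf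
  have e3 : 6 * |A * r| / r = 6 * |A| := by rw [abs_mul, abs_of_pos hr]; field_simp
  rw [e1, e3]
  have h1' : |A2 * r ^ 2 + 2 * (A1 * r)| ≤ |A2 * r ^ 2| + 2 * |A1 * r| := by
    have h2a : |2 * (A1 * r)| = 2 * |A1 * r| := by
      rw [abs_mul]; norm_num
    calc |A2 * r ^ 2 + 2 * (A1 * r)| ≤ |A2 * r ^ 2| + |2 * (A1 * r)| := abs_add_le _ _
      _ = |A2 * r ^ 2| + 2 * |A1 * r| := by rw [h2a]
  have h2' : |A1 * r + A| ≤ |A1 * r| + |A| := abs_add_le _ _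
  have e : ((kSlope3S tt : ℤ) : ℝ) / SC = (tt.2.2.absHi : ℝ) / SC + 8 * ((tt.2.1.absHi : ℝ) / SC) + 12 * ((tt.1.absHi : ℝ) / SC) := by
    simp only [kSlope3S]; push_cast; ring
  rw [e]
  linarith

/-- Scaled bound of `‖d_b‖³`: `⌈ndS2 · nd2S2 / SC⌉`. -/
def nd3S (c w : (Fin 3 × Fin 3) ⊕ Fin 3 → ℤ) (b : Fin 3 → ℤ) : ℤ := cdiv (ndS2 c w b * nd2S2 c w b) SC

/-- `‖d_b‖³ ≤ nd3S/SC`. [folklore] -/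
theorem norm_cube_le_nd3S {c w : (Fin 3 × Fin 3) ⊕ Fin 3 → ℤ} (U : E3 →L[ℝ] E3)
    (hbox : ∀ ab : Fin 3 × Fin 3, |(U (EuclideanSpace.single ab.2 (1 : ℝ))) ab.1 - (c (Sum.inl ab) : ℝ) / SC| ≤ (w (Sum.inl ab) : ℝ) / SC)
    (η : E3) (hη : ∀ i : Fin 3, |η i - (c (Sum.inr i) : ℝ) / SC| ≤ (w (Sum.inr i) : ℝ) / SC) (b : Fin 3 → ℤ) :
    ‖latPt U hexFrame b + U (hcpShift + η) - cenPt c b‖ ^ 3 ≤ (nd3S c w b : ℝ) / SC := by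
  have hS : (0 : ℝ) < SC := by norm_num [SC]
  set d := latPt U hexFrame b + U (hcpShift + η) - cenPt c b with hd
  have h1 : ‖d‖ ≤ (ndS2 c w b : ℝ) / SC := by rw [le_div_iff₀ hS]; exact norm_dVec2_le U hbox η hη b
  have h2 : ‖d‖ ^ 2 ≤ (nd2S2 c w b : ℝ) / SC := by rw [le_div_iff₀ hS]; exact norm_sq_dVec2_le U hbox η hη b
  have h3 : ‖d‖ ^ 3 ≤ (ndS2 c w b : ℝ) / SC * ((nd2S2 c w b : ℝ) / SC) := by
    rw [pow_succ', ]
    exact mul_le_mul h1 h2 (sq_nonneg _) ((norm_nonneg _).trans h1)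
  refine h3.trans ?_
  have hcd := div_le_cdiv (a := ndS2 c w b * nd2S2 c w b) (b := (SC : ℤ)) (by exact_mod_cast hS)
  have e : (ndS2 c w b : ℝ) / SC * ((nd2S2 c w b : ℝ) / SC) = ((ndS2 c w b * nd2S2 c w b : ℤ) : ℝ) / (SC : ℤ) / SC := by push_cast; ring
  rw [e, nd3S]
  exact div_le_div_of_nonneg_right (by exact_mod_cast hcd) hS.le

/-! ## §2. The quadratic term as the third-derivative tensor -/

/-- ★ The quadratic slope term equals `Σ_i (Σ_k Σ_k' Dreal a₁ α₀ p k k' i · d_k d_k') Δ_i`. [arithmetic] -/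
theorem quadSlope_eq (p d Δ : E3) (a₁ α₀ : ℝ) :
    (a₁ * ⟪p, d⟫ ^ 2 + α₀ * ‖d‖ ^ 2) * ⟪p, Δ⟫ + 2 * α₀ * ⟪p, d⟫ * ⟪d, Δ⟫ =
      ∑ i, (∑ k, ∑ k', Dreal a₁ α₀ p k k' i * (d k * d k')) * Δ i := by
  simp only [Dreal, inner_eq_sum3, norm_sq_eq_sum, Fin.sum_univ_three]
  simp only [Fin.isValue, ↓reduceIte, show ((0 : Fin 3) = 1) = False by decide, show ((0 : Fin 3) = 2) = False by decide,
    show ((1 : Fin 3) = 0) = False by decide, show ((1 : Fin 3) = 2) = False by decide, show ((2 : Fin 3) = 0) = False by decide,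
    show ((2 : Fin 3) = 1) = False by decide]
  ring

/-! ## §3. ★ The per-label third-order estimate -/

/-- ★ **PER-LABEL THIRD-ORDER SLOPE ESTIMATE, PURE LJ PROFILE** on any positive tube. [folklore chaining: `slopeForm_thirdOrder` with `B = betaLJ`,
`B₁ = α·r`, `B₂ = α′r + α`, `B₃ = α″r + 2α′`; `ljTripleFI`/`kSlope3_of_mem`; `a₁ = α′(ρ₀)/ρ₀` by `FI.divPos`] -/
theorem label_slope3_LJ {c w : (Fin 3 × Fin 3) ⊕ Fin 3 → ℤ} {b : Fin 3 → ℤ} (hlo : 0 < (tube2 c w b).lo)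
    {tt t0 : FI × FI × FI} {B0 a1q : FI}
    (htt : ljTripleFI ((tube2 c w b).mul (tube2 c w b)) = some tt) (ht0 : ljTripleFI (dot3 (cenVec c b) (cenVec c b)) = some t0)
    (hb0 : phiFI (dot3 (cenVec c b) (cenVec c b)) = some B0) (hq : FI.divPos t0.2.1 (dot3 (cenVec c b) (cenVec c b)) = some a1q)
    (U : E3 →L[ℝ] E3)
    (hbox : ∀ ab : Fin 3 × Fin 3, |(U (EuclideanSpace.single ab.2 (1 : ℝ))) ab.1 - (c (Sum.inl ab) : ℝ) / SC| ≤ (w (Sum.inl ab) : ℝ) / SC)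
    (η : E3) (hη : ∀ i : Fin 3, |η i - (c (Sum.inr i) : ℝ) / SC| ≤ (w (Sum.inr i) : ℝ) / SC) (Δ : E3) :
    FI.mem (alphaLJ ‖cenPt c b‖) t0.1 ∧ FI.mem (betaLJ ‖cenPt c b‖) B0 ∧ FI.mem (alpha1LJ ‖cenPt c b‖ / ‖cenPt c b‖) a1q ∧
      |betaLJ ‖latPt U hexFrame b + U (hcpShift + η)‖ * ⟪latPt U hexFrame b + U (hcpShift + η), Δ⟫ - betaLJ ‖cenPt c b‖ * ⟪cenPt c b, Δ⟫ -
          (alphaLJ ‖cenPt c b‖ * ⟪cenPt c b, latPt U hexFrame b + U (hcpShift + η) - cenPt c b⟫ * ⟪cenPt c b, Δ⟫ +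
            betaLJ ‖cenPt c b‖ * ⟪latPt U hexFrame b + U (hcpShift + η) - cenPt c b, Δ⟫) -
          ((alpha1LJ ‖cenPt c b‖ / ‖cenPt c b‖ * ⟪cenPt c b, latPt U hexFrame b + U (hcpShift + η) - cenPt c b⟫ ^ 2 +
              alphaLJ ‖cenPt c b‖ * ‖latPt U hexFrame b + U (hcpShift + η) - cenPt c b‖ ^ 2) * ⟪cenPt c b, Δ⟫ +
            2 * alphaLJ ‖cenPt c b‖ * ⟪cenPt c b, latPt U hexFrame b + U (hcpShift + η) - cenPt c b⟫ *
              ⟪latPt U hexFrame b + U (hcpShift + η) - cenPt c b, Δ⟫) / 2| ≤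
        ((kSlope3S tt : ℤ) : ℝ) / SC / 6 * ((nd3S c w b : ℝ) / SC) * ‖Δ‖ := by
  have hS : (0 : ℝ) < SC := by norm_num [SC]
  set T := tube2 c w b with hT
  set p := cenPt c b with hp
  set cb := latPt U hexFrame b + U (hcpShift + η) with hcb
  set d := cb - p with hd
  set aa : ℝ := (T.lo : ℝ) / SC with haa
  set bb : ℝ := (T.hi : ℝ) / SC with hbb
  have ha : 0 < aa := div_pos (by exact_mod_cast hlo) hS
  have hreg' : ∀ r, aa < r → r < bb → r ≠ 0 := fun r h1 _ => (ha.trans h1).ne'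
  have htube : ∀ t ∈ Set.Icc (0 : ℝ) 1, aa < segR p d t ∧ segR p d t < bb := fun t ht => by
    have := tube2_mem U hbox η hη b ht
    simpa [segR, hp, hd, hcb] using this
  set K : ℝ := ((kSlope3S tt : ℤ) : ℝ) / SC with hKdef
  have hSF := slopeForm_thirdOrder (B := betaLJ) (B₁ := fun s => alphaLJ s * s) (B₂ := fun s => alpha1LJ s * s + alphaLJ s)
    (B₃ := fun s => alpha2LJ s * s + 2 * alpha1LJ s) (K := K) (p := p) (d := d) (Δ := Δ) ha htube
    (fun r h1 h2 => hasDerivAt_betaLJ (hreg' r h1 h2))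
    (fun r h1 h2 => hasDerivAt_alphaLJ_mul (hreg' r h1 h2))
    (fun r h1 h2 => by
      have hne := hreg' r h1 h2
      have h := ((hasDerivAt_alpha1LJ hne).mul (hasDerivAt_id' r)).add (hasDerivAt_alphaLJ hne)
      exact h.congr_deriv (by simp; ring))
    (fun r h1 h2 => by
      have hmT : FI.mem r T := mem_of_strict h1 h2
      have hq2 : FI.mem (r ^ 2) (T.mul T) := by rw [sq]; exact FI.mem_mul hmT hmT
      obtain ⟨m0, m1, m2⟩ := mem_ljTripleFI hq2 htt
      have key := kSlope3_of_mem (ha.trans h1) m0 m1 m2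
      simpa only using key)
  -- centre data
  have h0t := htube 0 (by simp)
  have hR0 : segR p d 0 = ‖p‖ := by simp [segR]
  rw [hR0] at h0t
  have hρpos : 0 < ‖p‖ := ha.trans h0t.1
  have hρne : ‖p‖ ≠ 0 := hρpos.ne'
  have hQ0 := (mem_rho0 c b).1
  obtain ⟨m0c, m1c, _⟩ := mem_ljTripleFI hQ0 ht0
  have hβ0 : FI.mem (betaLJ ‖p‖) B0 := betaLJ_of_mem_phiFI hQ0 hb0
  have ha1 : FI.mem (alpha1LJ ‖p‖ / ‖p‖) a1q := by
    have := FI.mem_divPos hq m1c hQ0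
    have e : alpha1LJ ‖p‖ * ‖p‖ / ‖p‖ ^ 2 = alpha1LJ ‖p‖ / ‖p‖ := by field_simp
    rw [e] at this; exact this
  refine ⟨m0c, hβ0, ha1, ?_⟩
  have hpd : p + d = cb := by rw [hd]; abel
  simp only [hpd] at hSF
  -- rewrite the first- and second-order terms of `slopeForm_thirdOrder` into the stated closed forms
  have e1 : alphaLJ ‖p‖ * ‖p‖ * (⟪p, d⟫ / ‖p‖) = alphaLJ ‖p‖ * ⟪p, d⟫ := by field_simp
  have e2 : ((alpha1LJ ‖p‖ * ‖p‖ + alphaLJ ‖p‖) * (⟪p, d⟫ / ‖p‖) ^ 2 + alphaLJ ‖p‖ * ‖p‖ * ((‖d‖ ^ 2 - (⟪p, d⟫ / ‖p‖) ^ 2) / ‖p‖)) * ⟪p, Δ⟫ +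
      2 * (alphaLJ ‖p‖ * ‖p‖) * (⟪p, d⟫ / ‖p‖) * ⟪d, Δ⟫ =
      (alpha1LJ ‖p‖ / ‖p‖ * ⟪p, d⟫ ^ 2 + alphaLJ ‖p‖ * ‖d‖ ^ 2) * ⟪p, Δ⟫ + 2 * alphaLJ ‖p‖ * ⟪p, d⟫ * ⟪d, Δ⟫ := by
    field_simp
    ring
  rw [e1, e2] at hSF
  have hN : ‖d‖ ^ 3 ≤ (nd3S c w b : ℝ) / SC := norm_cube_le_nd3S U hbox η hη b
  have hK0 : 0 ≤ K := by
    have hmT : FI.mem ‖p‖ T := mem_of_strict h0t.1 h0t.2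
    have hq2 : FI.mem (‖p‖ ^ 2) (T.mul T) := by rw [sq]; exact FI.mem_mul hmT hmT
    obtain ⟨m0, m1, m2⟩ := mem_ljTripleFI hq2 htt
    have h := kSlope3_of_mem hρpos m0 m1 m2
    exact le_trans (by positivity) h
  have hbound : K / 6 * ‖d‖ ^ 3 * ‖Δ‖ ≤ K / 6 * ((nd3S c w b : ℝ) / SC) * ‖Δ‖ :=
    mul_le_mul_of_nonneg_right (mul_le_mul_of_nonneg_left hN (by linarith)) (norm_nonneg _)
  exact hSF.trans (by simpa [hKdef] using hbound)

end Summit.AtomisticToContinuum.Crystallization.Theorems.FrustratedLawDichotomyStrainedPatchHomSlopeLJThird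

end
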